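import Summits.KontsevichZagierPeriods.KontsevichZagierPeriods.Theorems.LinRedNormalFormArrangementNormalFormStubRebaseSimplePosOneFibreThick
import Summits.KontsevichZagierPeriods.KontsevichZagierPeriods.Theorems.LinRedNormalFormArrangementNormalFormStubRebaseSimpleZeroProductBlow

/-!
# Stub `stub_rebaseSimplePosMany`, part `rebaseSimplePosMany_product` (crux `ArrangementNormalForm`, line `janus-bands`) — `Tools`

Dictionary for the rebase of PRODUCT fibres over a base of dimension `B + 1` (silent
coordinates `x' ∈ ℝ^B`, distinguished `y`) with `K` fibres `tᵢ` — the `B`-generic, `K`-generic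
port of the one-dimensional-base dictionary `RebaseZero.*` — on the LITERAL class text
`GG B σ K`: full-base affine atoms `Cf B` with value `SeparatePos.affF`, their algebra, the base
cell `cell K M` (a cylinder set of `ℝ^{B+1+K}`), the product domain `pDom M U V` (a
`SeparatePos.gDom` with affine bounds `Uᵢ < tᵢ < Vᵢ`), the base-factor data `BData B`, product
representations `IsProd` (literal domain, literal integrand `RebasePos.glit`, base coordinates
bounded on the base cell), the target `Good B K` (congruent modulo `KZ.relations` to the subgroup
generated by `GG B 2 K`), the format `InFmt` (letter `y`-free, bounds `y`-free or `y` itself),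
the continuation hypothesis `HP` of the fibre-by-fibre induction, and the data
`pullMu/pullAl/pullDe` of the single-fibre affine pull-back. Registered:
`rebaseSimplePosMany_mem_pDom`.

References: M. Kontsevich, D. Zagier, *Periods* (2001), §1.2.
-/

noncomputable section

open Set MeasureTheory MvPolynomial
open Literature.NumberTheory.Transcendental Literature.ModelTheory.ExponentialFields

namespace Summit.KontsevichZagierPeriods.ArrangementNormalForm.JanusBands

namespace RebaseMany

open SeparatePos RebasePos

variable {B K : ℕ}

/-- Full-base affine atoms `c(x', y) = ∑ cⱼ zⱼ + c₀` of the literal text. [folklore] -/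
abbrev Cf (B : ℕ) : Type := (Fin (B + 1) → ℚ) × ℚ

/-- The atom `y` in the skeleton's spelling. [folklore] -/
def ySingle (B : ℕ) : Cf B := (Pi.single (Fin.last B) 1, 0)

/-- The constant atom `q`. [folklore] -/
def cst (B : ℕ) (q : ℚ) : Cf B := (0, q)

/-! ### Algebra of atoms -/

/-- `affF` is additive. [folklore] -/
theorem affF_add (c d : Cf B) (z : Fin (B + 1 + K) → ℝ) :
    affF B K (c + d) z = affF B K c z + affF B K d z := by
  simp only [affF, Prod.fst_add, Prod.snd_add, Pi.add_apply, Rat.cast_add, add_mul,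
    Finset.sum_add_distrib]
  ring

/-- `affF` of a difference. [folklore] -/
theorem affF_sub (c d : Cf B) (z : Fin (B + 1 + K) → ℝ) :
    affF B K (c - d) z = affF B K c z - affF B K d z := affF_sub' c d z

/-- `affF` of a negative. [folklore] -/
theorem affF_neg (c : Cf B) (z : Fin (B + 1 + K) → ℝ) : affF B K (-c) z = -affF B K c z :=
  affF_neg' c z

/-- `affF` of a scalar multiple. [folklore] -/
theorem affF_smul (q : ℚ) (c : Cf B) (z : Fin (B + 1 + K) → ℝ) :
    affF B K (q • c) z = (q : ℝ) * affF B K c z := by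
  simp only [affF, Prod.smul_fst, Prod.smul_snd, Pi.smul_apply, smul_eq_mul, Rat.cast_mul,
    Finset.mul_sum, mul_add]
  ring

/-- `affF` of zero. [folklore] -/
theorem affF_zero (z : Fin (B + 1 + K) → ℝ) : affF B K (0 : Cf B) z = 0 := affF_zero' z

/-- `affF` of a constant atom. [folklore] -/
@[simp] theorem affF_cst (q : ℚ) (z : Fin (B + 1 + K) → ℝ) : affF B K (cst B q) z = q := by
  simp [affF, cst]

/-- `affF` of the atom `y`. [folklore] -/
@[simp] theorem affF_ySingle (z : Fin (B + 1 + K) → ℝ) :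
    affF B K (ySingle B) z = z (Fin.castAdd K (Fin.last B)) := by
  rw [affF, Fin.sum_univ_castSucc, Finset.sum_eq_zero fun i _ => ?_]
  · simp [ySingle]
  · simp [ySingle]

/-- The `y`-slope of a constant atom. [folklore] -/
@[simp] theorem cst_fst (q : ℚ) (j : Fin (B + 1)) : (cst B q).1 j = 0 := rfl

/-- The `y`-slope of a sum. [folklore] -/
theorem add_fst_last (c d : Cf B) : (c + d).1 (Fin.last B) = c.1 (Fin.last B) + d.1 (Fin.last B) :=
  rfl

/-- The `y`-slope of a difference. [folklore] -/
theorem sub_fst_last (c d : Cf B) : (c - d).1 (Fin.last B) = c.1 (Fin.last B) - d.1 (Fin.last B) :=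
  rfl

/-- The `y`-slope of a negative. [folklore] -/
theorem neg_fst_last (c : Cf B) : (-c).1 (Fin.last B) = -c.1 (Fin.last B) := rfl

/-- The `y`-slope of a scalar multiple. [folklore] -/
theorem smul_fst_last (q : ℚ) (c : Cf B) : (q • c).1 (Fin.last B) = q * c.1 (Fin.last B) := rfl

/-- `affF` only reads the base coordinates. [folklore] -/
theorem affF_congr (c : Cf B) {z z' : Fin (B + 1 + K) → ℝ}
    (h : ∀ j : Fin (B + 1), z' (Fin.castAdd K j) = z (Fin.castAdd K j)) :
    affF B K c z' = affF B K c z := by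
  simp [affF, h]

/-- Base coordinates are not fibre coordinates. [folklore] -/
theorem castAdd_ne_natAdd' (j : Fin (B + 1)) (i : Fin K) :
    (Fin.castAdd K j : Fin (B + 1 + K)) ≠ Fin.natAdd (B + 1) i :=
  IntegrateOutLow.castAdd_ne_natAdd j i

/-- Distinct fibres have distinct coordinates. [folklore] -/
theorem natAdd_injective' : Function.Injective (fun i : Fin K => (Fin.natAdd (B + 1) i : Fin (B + 1 + K))) :=
  fun i j h => by
    have := congrArg Fin.val h
    simp only [Fin.val_natAdd] at this
    exact Fin.ext (by omega)

/-- `affF` is unchanged by updating a fibre coordinate. [folklore] -/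
@[simp] theorem affF_update (c : Cf B) (z : Fin (B + 1 + K) → ℝ) (i : Fin K) (x : ℝ) :
    affF B K c (Function.update z (Fin.natAdd (B + 1) i) x) = affF B K c z :=
  affF_congr c fun j => by rw [Function.update_of_ne (castAdd_ne_natAdd' j i)]

/-- The literal affine sum is `affF`. [folklore] -/
theorem sum_eq_affF (c : Cf B) (z : Fin (B + 1 + K) → ℝ) :
    (∑ i', (c.1 i' : ℝ) * z (Fin.castAdd K i') + (c.2 : ℝ)) = affF B K c z := rfl

/-- Affine players. [folklore] -/
theorem pv_inr (c : Cf B) (z : Fin (B + 1 + K) → ℝ) : pv (K := K) (Sum.inr c) z = affF B K c z :=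
  rfl

/-! ### Base cells and product domains -/

/-- The base cell `{∀ j, 0 < (M j)(x', y)}`, as a cylinder set of `ℝ^{B+1+K}`. [folklore] -/
def cell (K : ℕ) {m' : ℕ} (M : Fin m' → Cf B) : Set (Fin (B + 1 + K) → ℝ) :=
  {z | ∀ j, 0 < affF B K (M j) z}

/-- Membership in the base cell. [folklore] -/
theorem mem_cell {m' : ℕ} (M : Fin m' → Cf B) (z : Fin (B + 1 + K) → ℝ) :
    z ∈ cell K M ↔ ∀ j, 0 < affF B K (M j) z := Iff.rfl

/-- Adding a row to the base cell. [folklore] -/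
theorem mem_cell_snoc {m' : ℕ} (M : Fin m' → Cf B) (q : Cf B) (z : Fin (B + 1 + K) → ℝ) :
    z ∈ cell K (Fin.snoc M q : Fin (m' + 1) → Cf B) ↔ z ∈ cell K M ∧ 0 < affF B K q z := by
  simp only [cell, mem_setOf_eq, Fin.forall_fin_succ', Fin.snoc_castSucc, Fin.snoc_last]

/-- The base cell is unchanged by updating a fibre coordinate. [folklore] -/
@[simp] theorem update_mem_cell {m' : ℕ} (M : Fin m' → Cf B) (z : Fin (B + 1 + K) → ℝ) (i : Fin K)
    (x : ℝ) : Function.update z (Fin.natAdd (B + 1) i) x ∈ cell K M ↔ z ∈ cell K M := by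
  simp only [mem_cell, affF_update]

/-- The base cell only reads the base coordinates. [folklore] -/
theorem mem_cell_congr {m' : ℕ} (M : Fin m' → Cf B) {z z' : Fin (B + 1 + K) → ℝ}
    (h : ∀ j : Fin (B + 1), z' (Fin.castAdd K j) = z (Fin.castAdd K j)) :
    z' ∈ cell K M ↔ z ∈ cell K M := by
  simp only [mem_cell, affF_congr _ h]

/-- The product domain `{z ∈ cell M, Uᵢ < tᵢ < Vᵢ}` as a literal `gDom`. [folklore] -/
def pDom {m' : ℕ} (M : Fin m' → Cf B) (U V : Fin K → Cf B) : Set (Fin (B + 1 + K) → ℝ) :=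
  gDom B K m' M (fun i => Sum.inr (U i)) (fun i => Sum.inr (V i))

/-- Membership in a product domain. [folklore] -/
theorem mem_pDom {m' : ℕ} (M : Fin m' → Cf B) (U V : Fin K → Cf B) (z : Fin (B + 1 + K) → ℝ) :
    z ∈ pDom M U V ↔ z ∈ cell K M ∧
      ∀ i, affF B K (U i) z < z (Fin.natAdd (B + 1) i) ∧ z (Fin.natAdd (B + 1) i) < affF B K (V i) z := by
  simp only [pDom, gDom, cell, mem_setOf_eq, Sum.elim_inr, sum_eq_affF]

/-- Membership in a product domain, the fibre `i` singled out. [folklore] -/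
theorem mem_pDom_fibre {m' : ℕ} (M : Fin m' → Cf B) (U V : Fin K → Cf B) (i : Fin K)
    (z : Fin (B + 1 + K) → ℝ) :
    z ∈ pDom M U V ↔ z ∈ cell K M ∧
      (affF B K (U i) z < z (Fin.natAdd (B + 1) i) ∧ z (Fin.natAdd (B + 1) i) < affF B K (V i) z) ∧
      ∀ i', i' ≠ i → affF B K (U i') z < z (Fin.natAdd (B + 1) i') ∧
        z (Fin.natAdd (B + 1) i') < affF B K (V i') z := by
  rw [mem_pDom]
  refine and_congr_right fun _ => ⟨fun h => ⟨h i, fun i' _ => h i'⟩, fun h i' => ?_⟩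
  by_cases hi' : i' = i
  · rw [hi']; exact h.1
  · exact h.2 i' hi'

/-- Updating one affine bound. [folklore] -/
theorem update_inr (U : Fin K → Cf B) (i : Fin K) (c : Cf B) :
    Function.update (fun j => (Sum.inr (U j) : Fin K ⊕ Cf B)) i (Sum.inr c) =
      fun j => Sum.inr (Function.update U i c j) := by
  funext j
  by_cases h : j = i
  · subst h; simp
  · simp [Function.update_of_ne h]

/-- Product domains are semialgebraic. [folklore] -/
theorem isSemialgebraic_pDom {m' : ℕ} (M : Fin m' → Cf B) (U V : Fin K → Cf B) :
    IsSemialgebraic ℚ (pDom M U V) :=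
  isSemialgebraic_gDom _ _ _ _

/-- Product domains are measurable. [folklore] -/
theorem measurableSet_pDom {m' : ℕ} (M : Fin m' → Cf B) (U V : Fin K → Cf B) :
    MeasurableSet (pDom M U V) :=
  IsSemialgebraic.measurableSet_holds (isSemialgebraic_pDom M U V)

/-! ### Product representations and the target -/

/-- The base-factor data `L, e, ℓ₁, ℓ₂, n₁, n₂` of the literal text (never changed by the moves). -/
structure BData (B : ℕ) where
  /-- number of `x'`-denominators -/
  m : ℕ
  /-- the `x'`-denominators -/
  L : Fin m → (Fin B → ℚ) × ℚ
  /-- their exponents -/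
  e : Fin m → ℕ
  /-- first base centre -/
  ℓ₁ : (Fin B → ℚ) × ℚ
  /-- second base centre -/
  ℓ₂ : (Fin B → ℚ) × ℚ
  /-- numerator exponent -/
  n₁ : ℕ
  /-- denominator exponent -/
  n₂ : ℕ

/-- The literal integrand with base-factor data `T`, numerator `p` and letters `a`. [folklore] -/
def glitB (T : BData B) (p : MvPolynomial (Fin B) ℚ) (a : Fin K → Option (Cf B)) :
    (Fin (B + 1 + K) → ℝ) → ℝ :=
  glit B K p T.L T.e T.ℓ₁ T.ℓ₂ T.n₁ T.n₂ a

/-- `s` is the PRODUCT representation with rows `M`, bounds `Uᵢ < tᵢ < Vᵢ`, base-factor data `T`,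
numerator `p` and letters `a`, over a base cell with bounded base coordinates. [folklore] -/
structure IsProd (s : KZ.IntegralRep (B + 1 + K)) {m' : ℕ} (M : Fin m' → Cf B) (U V : Fin K → Cf B)
    (T : BData B) (p : MvPolynomial (Fin B) ℚ) (a : Fin K → Option (Cf B)) : Prop where
  /-- the domain is the product domain -/
  dom : s.domain = pDom M U V
  /-- the integrand is the literal one -/
  int : EqOn s.integrand (glitB T p a) s.domain
  /-- admissible exponents -/
  adm : T.n₁ = 0 ∨ T.n₂ = 0
  /-- the base coordinates are bounded on the base cell -/
  cbd : ∃ R : ℝ, ∀ z ∈ cell K M, ∀ j : Fin (B + 1), |z (Fin.castAdd K j)| ≤ R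

/-- `GOOD` formal combinations: congruent modulo `KZ.relations` to the subgroup generated by the
literal class `GG B 2 K`. [folklore] -/
def Good (B K : ℕ) (x : KZ.FormalRep) : Prop :=
  ∃ c ∈ AddSubgroup.closure (GGset B 2 K), x - c ∈ KZ.relations

/-- Fibre data IN FORMAT: `y`-free letter, bounds `y`-free or literally `y`. [folklore] -/
def InFmt (a : Option (Cf B)) (U V : Cf B) : Prop :=
  (∀ c, a = some c → c.1 (Fin.last B) = 0) ∧
    (U.1 (Fin.last B) = 0 ∨ U = ySingle B) ∧ (V.1 (Fin.last B) = 0 ∨ V = ySingle B)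

/-- The CONTINUATION hypothesis of the fibre-by-fibre induction: every product representation
(same `T`) whose fibre `i` is in format and whose other fibres carry the data `(a, U, V)` is
good. [folklore] -/
def HP (T : BData B) (i : Fin K) (U V : Fin K → Cf B) (a : Fin K → Option (Cf B)) : Prop :=
  ∀ (m' : ℕ) (s : KZ.IntegralRep (B + 1 + K)) (M : Fin m' → Cf B) (U' V' : Fin K → Cf B)
    (p : MvPolynomial (Fin B) ℚ) (a' : Fin K → Option (Cf B)), IsProd s M U' V' T p a' →
    InFmt (a' i) (U' i) (V' i) → (∀ j, j ≠ i → a' j = a j ∧ U' j = U j ∧ V' j = V j) →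
    Good B K (KZ.of s)

/-! ### The data of the single-fibre moves -/

/-- Scalings of the single-fibre pull-back: `μ` at `i`, `1` elsewhere. [folklore] -/
def pullMu (i : Fin K) (μ : ℚ) : Fin K → ℚ := Function.update (fun _ => 1) i μ

/-- Shear slopes of the single-fibre pull-back: `α` at `i`, `0` elsewhere. [folklore] -/
def pullAl (i : Fin K) (α : ℚ) : Fin K → ℚ := Function.update (fun _ => 0) i α

/-- Shifts of the single-fibre pull-back: `δ` at `i`, `0` elsewhere. [folklore] -/
def pullDe (i : Fin K) (δ : (Fin B → ℚ) × ℚ) : Fin K → (Fin B → ℚ) × ℚ :=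
  Function.update (fun _ => 0) i δ

/-- The data at `i`. [folklore] -/
theorem pullData_self (i : Fin K) (μ α : ℚ) (δ : (Fin B → ℚ) × ℚ) :
    pullMu i μ i = μ ∧ pullAl i α i = α ∧ pullDe i δ i = δ := by
  simp [pullMu, pullAl, pullDe]

/-- The data off `i`. [folklore] -/
theorem pullData_of_ne (i : Fin K) (μ α : ℚ) (δ : (Fin B → ℚ) × ℚ) {j : Fin K} (hj : j ≠ i) :
    pullMu i μ j = 1 ∧ pullAl i α j = 0 ∧ pullDe i δ j = 0 := by
  simp [pullMu, pullAl, pullDe, Function.update_of_ne hj]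

/-- The scalings of the single-fibre pull-back are non-zero. [folklore] -/
theorem pullMu_ne_zero (i : Fin K) {μ : ℚ} (hμ : μ ≠ 0) (j : Fin K) : pullMu i μ j ≠ 0 := by
  by_cases hj : j = i
  · subst hj; simpa [pullMu]
  · simp [pullMu, Function.update_of_ne hj]

/-- The trivial pull-back is the identity on atoms. [folklore] -/
theorem pullC_one_zero : pullC (B := B) 1 0 0 = id := by
  funext c
  refine Prod.ext (funext fun j => ?_) ?_
  · refine Fin.lastCases ?_ (fun j => ?_) j
    · simp [pullC]
    · simp [pullC]
  · simp [pullC]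

/-- The single-fibre substitution fixes the spectator fibres. [folklore] -/
theorem pullInv_single_of_ne (i : Fin K) (μ α : ℚ) (δ : (Fin B → ℚ) × ℚ) (w : Fin (B + 1 + K) → ℝ)
    {j : Fin K} (hj : j ≠ i) :
    pullInv (pullMu i μ) (pullAl i α) (pullDe i δ) w (Fin.natAdd (B + 1) j) = w (Fin.natAdd (B + 1) j) := by
  obtain ⟨h1, h2, h3⟩ := pullData_of_ne i μ α δ hj
  rw [pullInv_fib, h1, h2, h3]
  simp [affB]

/-- The single-fibre substitution on the fibre `i`: `tᵢ ↦ μ tᵢ + α y + δ(x')`. [folklore] -/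
theorem pullInv_single_self (i : Fin K) (μ α : ℚ) (δ : (Fin B → ℚ) × ℚ) (w : Fin (B + 1 + K) → ℝ) :
    pullInv (pullMu i μ) (pullAl i α) (pullDe i δ) w (Fin.natAdd (B + 1) i) =
      (μ : ℝ) * w (Fin.natAdd (B + 1) i) + (α : ℝ) * w (Fin.castAdd K (Fin.last B)) + affB B K δ w := by
  obtain ⟨h1, h2, h3⟩ := pullData_self i μ α δ
  rw [pullInv_fib, h1, h2, h3]

/-- The atom `α y + δ(x')` assembled from a slope and an `x'`-part. [folklore] -/
def glue (α : ℚ) (δ : (Fin B → ℚ) × ℚ) : Cf B := (Fin.snoc δ.1 α, δ.2)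

/-- Value of `glue`. [folklore] -/
theorem affF_glue (α : ℚ) (δ : (Fin B → ℚ) × ℚ) (z : Fin (B + 1 + K) → ℝ) :
    affF B K (glue α δ) z = (α : ℝ) * z (Fin.castAdd K (Fin.last B)) + affB B K δ z := by
  simp only [affF, glue, affB, Fin.sum_univ_castSucc, Fin.snoc_castSucc, Fin.snoc_last]
  ring

/-- `glue` inverts `(slope, restr)`. [folklore] -/
theorem glue_restr (c : Cf B) : glue (c.1 (Fin.last B)) (restr B c) = c := by
  refine Prod.ext (funext fun j => ?_) rfl
  refine Fin.lastCases ?_ (fun j => ?_) j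
  · simp [glue]
  · simp [glue, restr]

/-- The `y`-slope of `glue`. [folklore] -/
@[simp] theorem glue_fst_last (α : ℚ) (δ : (Fin B → ℚ) × ℚ) : (glue α δ).1 (Fin.last B) = α := by
  simp [glue]

/-- The single-fibre substitution on the fibre `i`, atom form. [folklore] -/
theorem pullInv_single_self' (i : Fin K) (μ α : ℚ) (δ : (Fin B → ℚ) × ℚ) (w : Fin (B + 1 + K) → ℝ) :
    pullInv (pullMu i μ) (pullAl i α) (pullDe i δ) w (Fin.natAdd (B + 1) i) =
      (μ : ℝ) * w (Fin.natAdd (B + 1) i) + affF B K (glue α δ) w := by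
  rw [pullInv_single_self, affF_glue, add_assoc]

end RebaseMany

/-- Registered support goal of this file: membership in a product domain of the literal text over
a base of dimension `B + 1` with `K` fibres. -/
theorem rebaseSimplePosMany_mem_pDom (B K m' : ℕ) (M : Fin m' → (Fin (B + 1) → ℚ) × ℚ) (U V : Fin K → (Fin (B + 1) → ℚ) × ℚ) (z : Fin (B + 1 + K) → ℝ) : z ∈ RebaseMany.pDom M U V ↔ z ∈ RebaseMany.cell K M ∧ ∀ i, SeparatePos.affF B K (U i) z < z (Fin.natAdd (B + 1) i) ∧ z (Fin.natAdd (B + 1) i) < SeparatePos.affF B K (V i) z :=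
  RebaseMany.mem_pDom M U V z

end Summit.KontsevichZagierPeriods.ArrangementNormalForm.JanusBands
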